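import Summits.ResolutionOfSingularities.ResolutionOfSingularities.Theses.FoliationDescent
import Literature.AlgebraicGeometry.Resolution.QuadraticTransformsRegular
import Literature.AlgebraicGeometry.Resolution.RsopMonomialIdeals
import HarnessLib

/-!
# Crux `FolLU` (stmt-ResolutionOfSingularities-17081), line `birth`
# — stub `stub_regularAtCtr_blowupChart`

**The chart of the blow-up of a regular centre, re-localised at the new centre of the
valuation, is regular** (Liu, *Algebraic Geometry and Arithmetic Curves*, Thm. 8.1.19 (a)), in
the route's subalgebra-of-`K` encoding: `S ≤ O` a finitely generated `k`-subalgebra of `K` with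
`Frac S = K`, regular at the centre of `O` with local ring `R = S_𝔭` (`𝔭 = S ∩ 𝔪_O`);
`Z ⊆ W ⊆ S` finite, the images of `W` a regular system of parameters of `R`; `x₁ ∈ Z`
non-zero with all `z / x₁ ∈ O`. Then `S' = S[z/x₁ : z ∈ Z] ≤ O` is finitely generated,
`Frac S' = K`, and `S'` is regular at the centre of `O`.

Proof (a bridge to the tree's commutative algebra): the images `x` of `Z` in `R` are part of a
regular system of parameters, hence quasi-regular with `R/(x)` regular
(`isQuasiRegular_rsop_comp`, `isRsopPart_comp_of_rsop`), so the chart ring `(R[It])_{(x₁t)}` is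
regular (`isRegularRing_blowupChart`) and so is its isomorphic image
`C = R[z/x₁ : z ∈ Z] ⊆ K` (`isRegularRing_closure_of_isRegularRing_blowupChart`, via the
canonical embedding `R → K`). As `C ≤ O`, `C` localised at the centre of `O` is a regular local
ring (`isRegularLocalRing_locAtCentre_of_isRegularRing`), and this localisation (inside `K`)
coincides with that of `S'` because `S' ≤ C ≤ (S')_{𝔪_O ∩ S'}`.

References: Q. Liu, *Algebraic Geometry and Arithmetic Curves*, OUP 2002, Thm. 8.1.19 (a);
H. Matsumura, *Commutative Ring Theory*, Thms. 14.2, 16.2.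
-/

set_option linter.dupNamespace false -- mandated namespace of this single-conjunct summit

noncomputable section

open Literature.AlgebraicGeometry.Resolution IsLocalRing

namespace Summit.ResolutionOfSingularities.ResolutionOfSingularities.Theorems.FolLU

namespace BlowupChartRegular

universe u

/-- `k[S ∪ T] ≤ C` for a subring `C ⊆ K` containing the `k`-subalgebra `S` and the set `T`.
[folklore] -/
theorem toSubring_adjoin_union_le {k K : Type*} [Field k] [Field K] [Algebra k K]
    (S : Subalgebra k K) (T : Set K) (C : Subring K) (hS : (S : Set K) ⊆ C) (hT : T ⊆ C) :
    (Algebra.adjoin k ((S : Set K) ∪ T)).toSubring ≤ C := by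
  rw [Algebra.adjoin_eq_ring_closure]
  exact Subring.closure_le.mpr (Set.union_subset
    (Set.range_subset_iff.mpr fun c => hS (S.algebraMap_mem c)) (Set.union_subset hS hT))

/-- `k[S ∪ g(Z)]` is finitely generated if `S` is and `Z` is finite. [folklore] -/
theorem fg_adjoin_union_image {k K : Type*} [Field k] [Field K] [Algebra k K]
    (S : Subalgebra k K) (hfg : S.FG) (Z : Finset K) (g : K → K) :
    (Algebra.adjoin k ((S : Set K) ∪ g '' ↑Z)).FG := by
  classical
  rw [Algebra.adjoin_union, Algebra.adjoin_eq, ← Finset.coe_image]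
  exact hfg.sup (Subalgebra.fg_adjoin_finset _)

/-- A subalgebra of `K` containing one with fraction field `K` has fraction field `K`.
[folklore] -/
theorem isFractionRing_of_le {k K : Type*} [Field k] [Field K] [Algebra k K]
    (S S' : Subalgebra k K) (h : S ≤ S') (hfrac : IsFractionRing S K) : IsFractionRing S' K := by
  haveI := hfrac
  refine IsFractionRing.of_field (R := S') (K := K) fun z => ?_
  obtain ⟨a, b, -, rfl⟩ := IsFractionRing.div_surjective (A := S) z
  exact ⟨⟨a, h a.2⟩, ⟨b, h b.2⟩, rfl⟩

/-- **The local ring `B_𝔭` of a subring `B ⊆ K` embeds canonically in `K`**, extending the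
inclusion of `B`, with image the fractions `a / s`, `a ∈ B`, `s ∈ B ∖ 𝔭`. [folklore] -/
theorem exists_ringHom_atPrime {K : Type*} [Field K] (B : Subring K) (P : Ideal B) [P.IsPrime] :
    ∃ f : Localization.AtPrime P →+* K, Function.Injective f ∧
      (∀ b : B, f (algebraMap B (Localization.AtPrime P) b) = b) ∧
      ∀ q : Localization.AtPrime P, ∃ a s : B, s ∉ P ∧ f q = (a : K) / (s : K) := by
  have hne : ∀ s : P.primeCompl, ((s : B) : K) ≠ 0 := by
    intro s h0
    have : (s : B) = 0 := Subtype.ext h0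
    exact (Ideal.mem_primeCompl_iff.mp s.2) (this ▸ P.zero_mem)
  have hg : ∀ s : P.primeCompl, IsUnit (B.subtype s) := fun s => isUnit_iff_ne_zero.mpr (hne s)
  refine ⟨IsLocalization.lift hg, ?_, fun b => IsLocalization.lift_eq hg b, fun q => ?_⟩
  · rw [IsLocalization.lift_injective_iff]
    intro a b
    constructor
    · intro h
      exact congrArg B.subtype
        (IsLocalization.injective (Localization.AtPrime P) P.primeCompl_le_nonZeroDivisors h)
    · intro h
      rw [Subtype.val_injective h]
  · obtain ⟨a, s, rfl⟩ := IsLocalization.exists_mk'_eq P.primeCompl q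
    refine ⟨a, s, Ideal.mem_primeCompl_iff.mp s.2, ?_⟩
    refine (IsLocalization.lift_mk'_spec hg a _ s).mpr ?_
    change (a : K) = ((s : B) : K) * ((a : K) / ((s : B) : K))
    rw [← mul_div_assoc, mul_div_cancel_left₀ _ (hne s)]

/-- **The chart `R[x_j/x_i] ⊆ K` of the blow-up of a regular local ring `R ⊆ K` along part `x`
of a regular system of parameters `w` is a regular ring**: `x` is quasi-regular with `R/(x)`
regular (Matsumura 14.2, 16.2), so the chart ring `(R[It])_{(x_i t)}` is regular (Liu 8.1.19 (a)
at ring level, `isRegularRing_blowupChart`), and it maps isomorphically onto `R[x_j/x_i]`.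
[cite: Liu2002, Thm. 8.1.19 (a)] -/
theorem isRegularRing_closure_chart_of_rsop {K : Type u} [Field K] {R : Type u} [CommRing R]
    [IsRegularLocalRing R] {d : ℕ} (hd : (maximalIdeal R).spanFinrank = d) (w : Fin d → R)
    (hw : Ideal.span (Set.range w) = maximalIdeal R) {r : ℕ} (ι : Fin r → Fin d)
    (hι : Function.Injective ι) (x : Fin r → R) (hx : w ∘ ι = x) (i : Fin r) (f : R →+* K)
    (hf : Function.Injective f) (hxi : f (x i) ≠ 0) :
    IsRegularRing
      (Subring.closure ((f.range : Set K) ∪ Set.range fun j => f (x j) / f (x i))) := by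
  subst hx
  haveI : IsRegularRing R := isRegularRing_of_isRegularLocalRing R
  haveI : IsRegularRing (R ⧸ Ideal.span (Set.range (w ∘ ι))) := by
    haveI := (isRsopPart_comp_of_rsop hd w hw ι hι).isRegularLocalRing_quotient
    exact isRegularRing_of_isRegularLocalRing _
  exact isRegularRing_closure_of_isRegularRing_blowupChart f (w ∘ ι) i hf hxi
    (isRegularRing_blowupChart (w ∘ ι) i (isQuasiRegular_rsop_comp hd w hw ι hι))

/-- Re-indexing: a family on a finset `W ⊆ K` and a sub-finset `Z ⊆ W` become a `Fin`-indexed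
family and an injective sub-family. [folklore] -/
theorem exists_subfamily {K R : Type*} (W Z : Finset K) (hZW : Z ⊆ W) (v : ↥(W : Set K) → R) :
    ∃ (w : Fin W.card → R) (x : Fin Z.card → R) (ι : Fin Z.card → Fin W.card),
      Function.Injective ι ∧ w ∘ ι = x ∧ Set.range w = Set.range v ∧
      (∀ j, ∃ (z : K) (hz : z ∈ Z), x j = v ⟨z, hZW hz⟩) ∧
      ∀ (z : K) (hz : z ∈ Z), ∃ j, x j = v ⟨z, hZW hz⟩ := by
  refine ⟨fun i => v ⟨(W.equivFin.symm i : K), (W.equivFin.symm i).2⟩,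
    fun j => v ⟨(Z.equivFin.symm j : K), hZW (Z.equivFin.symm j).2⟩,
    fun j => W.equivFin ⟨(Z.equivFin.symm j : K), hZW (Z.equivFin.symm j).2⟩,
    ?_, ?_, ?_, ?_, ?_⟩
  · intro a b hab
    have h := congrArg Subtype.val (W.equivFin.injective hab)
    exact Z.equivFin.symm.injective (Subtype.ext h)
  · funext j
    simp only [Function.comp_apply, Equiv.symm_apply_apply]
  · ext y
    constructor
    · rintro ⟨i, rfl⟩
      exact ⟨_, rfl⟩
    · rintro ⟨u, rfl⟩
      exact ⟨W.equivFin ⟨u, u.2⟩, by simp only [Equiv.symm_apply_apply]⟩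
  · intro j
    exact ⟨_, (Z.equivFin.symm j).2, rfl⟩
  · intro z hz
    exact ⟨Z.equivFin ⟨z, hz⟩, by simp only [Equiv.symm_apply_apply]⟩

end BlowupChartRegular

open BlowupChartRegular

/-- STUB `stub_regularAtCtr_blowupChart`. **The chart of the blow-up of a regular centre,
re-localised at the new centre of the valuation, is regular** (Liu, *Algebraic Geometry and
Arithmetic Curves*, Thm. 8.1.19 (a); in tree at ring level: `isRegularRing_blowupChart`,
`isRegularRing_closure_of_isRegularRing_blowupChart`,
`isRegularLocalRing_locAtCentre_of_isRegularRing`). In the route's encoding: `S ≤ O` f.g. with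
`Frac S = K`, regular at the centre with local ring `R := S_c` (the displayed
`Localization.AtPrime`); `Z ⊆ W ⊆ S` finite, where the images of `W` form a regular system of
parameters of `R` (they generate `𝔪_R` and `#W = embdim R`), so that `Z` is part of one;
`x₁ ∈ Z`, `x₁ ≠ 0`, and all `z/x₁ ∈ O`. Then `S' := S[z/x₁ : z ∈ Z] ≤ O` is f.g.,
`Frac S' = K`, and `S'` is regular at the centre of `O`. [cite: Liu2002, Thm. 8.1.19 (a)] -/
theorem stub_regularAtCtr_blowupChart :
    ∀ (k K : Type) [Field k] [Field K] [Algebra k K] (O : ValuationSubring K) (S : Subalgebra k K)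
    (hS : S.toSubring ≤ O.toSubring) (Z : Finset K) (x₁ : K),
    S.FG → IsFractionRing S K →
    IsRegularLocalRing
      (Localization.AtPrime (Ideal.comap (Subring.inclusion hS) (IsLocalRing.maximalIdeal O))) →
    x₁ ∈ Z → x₁ ≠ 0 → (∀ z ∈ Z, z / x₁ ∈ O) →
    (∃ (W : Finset K) (hW : (↑W : Set K) ⊆ S), Z ⊆ W ∧
      Ideal.span (Set.range fun w : (W : Set K) =>
          algebraMap (↥S.toSubring)
            (Localization.AtPrime (Ideal.comap (Subring.inclusion hS) (IsLocalRing.maximalIdeal O)))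
            ⟨(w : K), hW w.2⟩) =
        IsLocalRing.maximalIdeal
          (Localization.AtPrime (Ideal.comap (Subring.inclusion hS) (IsLocalRing.maximalIdeal O))) ∧
      (IsLocalRing.maximalIdeal
          (Localization.AtPrime
            (Ideal.comap (Subring.inclusion hS) (IsLocalRing.maximalIdeal O)))).spanFinrank = W.card) →
    ∃ h' : (Algebra.adjoin k (↑S ∪ (fun z => z / x₁) '' ↑Z)).toSubring ≤ O.toSubring,
      S ≤ Algebra.adjoin k (↑S ∪ (fun z => z / x₁) '' ↑Z) ∧
      (Algebra.adjoin k (↑S ∪ (fun z => z / x₁) '' ↑Z)).FG ∧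
      IsFractionRing ↥(Algebra.adjoin k (↑S ∪ (fun z => z / x₁) '' ↑Z)) K ∧
      IsRegularLocalRing
        (Localization.AtPrime (Ideal.comap (Subring.inclusion h') (IsLocalRing.maximalIdeal O))) := by
  intro k K _ _ _ O S hS Z x₁ hfg hfrac hreg hx₁Z hx₁0 hZO hW
  obtain ⟨W, hWS, hZW, hspan, hcard⟩ := hW
  set P : Ideal S.toSubring := Ideal.comap (Subring.inclusion hS) (IsLocalRing.maximalIdeal O)
  set S' : Subalgebra k K := Algebra.adjoin k (↑S ∪ (fun z => z / x₁) '' ↑Z)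
  -- the easy conjuncts
  have h' : S'.toSubring ≤ O.toSubring := by
    refine toSubring_adjoin_union_le S _ O.toSubring hS ?_
    rintro _ ⟨z, hz, rfl⟩
    exact hZO z hz
  have hSS' : S ≤ S' := fun s hs => Algebra.subset_adjoin (Or.inl hs)
  refine ⟨h', hSS', fg_adjoin_union_image S hfg Z _, isFractionRing_of_le S S' hSS' hfrac, ?_⟩
  -- regularity: the canonical embedding `f : R = S_𝔭 → K`
  haveI := hreg
  obtain ⟨f, hf, hfalg, hffrac⟩ := exists_ringHom_atPrime S.toSubring P
  -- the images of `Z` as a sub-family `x = w ∘ ι` of the regular system of parameters `w`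
  obtain ⟨w, x, ι, hι, hwx, hrange, hxZ, hZx⟩ := exists_subfamily W Z hZW
    (fun w : (W : Set K) =>
      algebraMap (↥S.toSubring) (Localization.AtPrime P) ⟨(w : K), hWS w.2⟩)
  have hw : Ideal.span (Set.range w) = maximalIdeal (Localization.AtPrime P) := by
    rw [hrange]; exact hspan
  have hfx : ∀ j, ∃ z ∈ Z, f (x j) = z := by
    intro j
    obtain ⟨z, hz, hj⟩ := hxZ j
    exact ⟨z, hz, by rw [hj]; exact hfalg _⟩
  obtain ⟨i₀, hi₀⟩ := hZx x₁ hx₁Z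
  have hfi₀ : f (x i₀) = x₁ := by rw [hi₀]; exact hfalg _
  have hxi₀ : f (x i₀) ≠ 0 := by rw [hfi₀]; exact hx₁0
  -- the chart `C = R[z/x₁ : z ∈ Z] ⊆ K` is a regular ring
  set C : Subring K :=
    Subring.closure ((f.range : Set K) ∪ Set.range fun j => f (x j) / f (x i₀))
  haveI hCreg : IsRegularRing C :=
    isRegularRing_closure_chart_of_rsop hcard w hw ι hι x hwx i₀ f hf hxi₀
  -- `S' ≤ C ≤ (S')_{𝔪_O ∩ S'} ≤ O`
  have hS'C : S'.toSubring ≤ C := by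
    refine toSubring_adjoin_union_le S _ C ?_ ?_
    · intro s hs
      exact Subring.subset_closure
        (Or.inl ⟨algebraMap (↥S.toSubring) _ ⟨s, hs⟩, hfalg ⟨s, hs⟩⟩)
    · rintro _ ⟨z, hz, rfl⟩
      obtain ⟨j, hj⟩ := hZx z hz
      refine Subring.subset_closure (Or.inr ⟨j, ?_⟩)
      change f (x j) / f (x i₀) = z / x₁
      rw [hfi₀, hj, hfalg]
  have hCL : C ≤ locAtCentre S'.toSubring O := by
    refine Subring.closure_le.mpr (Set.union_subset ?_ ?_)
    · rintro _ ⟨q, rfl⟩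
      obtain ⟨a, s, hs, hq⟩ := hffrac q
      rw [hq]
      exact ⟨a, hSS' a.2, s, hSS' s.2, valuation_eq_one_of_not_mem_subringCentre hS hs, rfl⟩
    · rintro _ ⟨j, rfl⟩
      obtain ⟨z, hz, hj⟩ := hfx j
      change f (x j) / f (x i₀) ∈ locAtCentre S'.toSubring O
      rw [hj, hfi₀]
      exact le_locAtCentre _ O (Algebra.subset_adjoin (Or.inr ⟨z, hz, rfl⟩))
  have hCO : C ≤ O.toSubring := hCL.trans (locAtCentre_le h')
  have hreg₁ : IsRegularLocalRing (locAtCentre C O) :=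
    isRegularLocalRing_locAtCentre_of_isRegularRing hCO
  have hEq : locAtCentre C O = locAtCentre S'.toSubring O :=
    le_antisymm ((locAtCentre_mono O hCL).trans (locAtCentre_locAtCentre _ O).le)
      (locAtCentre_mono O hS'C)
  have hreg₂ : IsRegularLocalRing (locAtCentre S'.toSubring O) := hEq ▸ hreg₁
  exact (isRegularLocalRing_locAtCentre_iff h').mp hreg₂

end Summit.ResolutionOfSingularities.ResolutionOfSingularities.Theorems.FolLU

end
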